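import Summits.NavierStokesRegularity.NavierStokesRegularity.Theses.TautLoopKelvin
import Summits.NavierStokesRegularity.NavierStokesRegularity.Theorems.TautLoopKelvinTautCompressionIntegrableStubExtension
import Literature.Analysis.FluidPDE.SuitableWeak
import HarnessLib.Audit

/-!
# Birth skeleton of the crux `TautLoopKelvin.TautCompressionIntegrable` — reshape r1 (line lead)

(crux item `stmt-NavierStokesRegularity-15248`, rank 2, route `route-NavierStokesRegularity-TautLoopKelvin`;
tree path `Cruxes/TautCompressionIntegrable/Lines/birth.lean`; registrar of the birth shape
`planner-skel-stmt-NavierStokesRegularity-15248-0`; reshape r1 by the line lead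
`prover-line-stmt-NavierStokesRegularity-15248-0`, 2026-08-17, after wave 1.)

THE CRUX (K1). For every `ν > 0`, every classical solution `u` of unforced NS on `ℝ³ × [0,T)` which is Leray–Hopf on
`[0,T]` from a rapidly decaying datum, and every level `g > 0`, the NEAR-TAUT COMPRESSION RATE
`Λ_g(s) := ⨅_{ε>0} sSup { −⨍_γ ⟨τ,(∇u(s))τ⟩ : γ a C¹ loop, |∮_γ u(s)·dl| ≥ g, length(γ) ≤ ℓ(g,s) + ε }`
has a measurable majorant `Φ` on `(0,T)` with `∫⁻_(0,T) Φ⁺ ≤ M < ∞`.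

WHAT WAVE 1 SETTLED (landed, kernel-checked, axioms ⊆ {propext, Classical.choice, Quot.sound}):
* birth stub 1 `stub_nearTautCompression_le_of_fderiv_le` (static loop-space bound `Λ_g(v) ≤ L` when `‖Dv‖ ≤ L`;
  all `ℝ`-valued junk conventions handled) — p158737,
  `Theorems/TautLoopKelvinTautCompressionIntegrableStubNearTaut.lean`;
* birth stub 2 `stub_fderiv_bound_of_velocity_bound` (bounded velocity ⇒ bounded gradient on `[0,T) × ℝ³`, via
  `hasSmoothExtensionPast_of_bounded_holds`, Fatou at `t = T`, `tao2011_hasBoundedSobolevNormsOn_holds`, Sobolev) —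
  p158660, `Theorems/TautLoopKelvinTautCompressionIntegrableStubGradientBound.lean`;
* the dictionary `extends past T ⇔ bounded on [0,T)×ℝ³` is in the tree (`FastClassSqueeze.bounded_of_hasSmoothExtensionPast`,
  `hasSmoothExtensionPast_of_bounded_holds`).

THE RESHAPE. The birth trichotomy "bounded / unbounded ∧ Type-I / ¬Type-I" is restated through the proved dictionary as
"extends past T / genuine blow-up at T with the Type-I rate / genuine blow-up at T without it":

* `stub_conclusion_of_hasSmoothExtensionPast` [PROVED from stubs 1–2 + `bounded_of_hasSmoothExtensionPast`; LANDED p159529 as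
  `Theorems/TautLoopKelvinTautCompressionIntegrableStubExtension.lean`]: if `u` extends classically past `T`, the
  conclusion of K1 holds for `u` at every level (`Φ :≡ L`, `M := L·T`). This is the "S ⇒ K1 per solution" lemma every
  idea card of the crux (`cs-wavenumber-below-the-loop`, `bfg-sparse-girdle`, `dissipation-clock-transfer`,
  `pinched-marker-liouville`) ends with.
* `stub_typeIBlowup_endgame` [OPEN]: the conclusion of K1 for a solution of the class that does NOT extend past `T`
  and has the Type-I rate at `T` (`IsTypeIBlowup u T`). Implied verbatim by the open item
  `TypeICertificateLadder.NoTypeIBlowup` (stmt-NavierStokesRegularity-1217), under which this regime is EMPTY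
  (`typeIBlowup_endgame_of_noTypeIBlowup` in the StubExtension file); in-tree feeders of that item:
  `LiouvilleConjectureNS` via `typeIExtends_of_liouvilleConjectureNS`, `ClockStretchingLaw.NoSingularTypeIModel` via
  `clockStretchingLaw_singularZoom_proof` (all open). A proof NOT going through emptiness of the regime would be a
  genuine saturation-rigidity theorem for the taut quantum loops of a Type-I blow-up (the birth card's reading).
* `stub_nonTypeIBlowup_endgame` [OPEN, hardest]: the same for a genuine blow-up WITHOUT the Type-I rate. Implied
  verbatim by the open item `TypeICertificateLadder.NoTypeII` (stmt-NavierStokesRegularity-0056), under which this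
  regime is EMPTY (`nonTypeIBlowup_endgame_of_noTypeII`); no Type-II-specific tool exists in the tree or in print.

`TautCompressionIntegrable_of_signatures` is the closed composition (excluded middle on `HasSmoothExtensionPast ν 0 u T`,
then on `IsTypeIBlowup u T`); `TautCompressionIntegrable_of : TautCompressionIntegrable` instantiates it with the three
stubs BY NAME (the only theorem concluding the crux by name; no `Prop` hypotheses, no direct `sorry`).
Sorries: exactly the two open stubs (stub E is the landed theorem). Given the two open items 1217 ∧ 0056 (= no blow-up in the class) both singular
regimes are empty and K1 follows (`tautCompressionIntegrable_of_noBlowup`, StubExtension file): the line has proved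
"regularity ⇒ K1" unconditionally and located the open content of K1 exactly at the blow-up scenario, split by rate.

LOAD-BEARING CHECK. The extension stub alone misses every genuine blow-up; the two endgame stubs alone miss every regular
`T`; neither endgame stub is the crux (each carries an undischargeable regime hypothesis) nor the summit (each concerns one
rate class and concludes a loop-functional bound, not continuation).
-/

noncomputable section

open MeasureTheory Filter Topology Set
open Literature.Analysis.FluidPDE

namespace Summit.NavierStokesRegularity.NavierStokesRegularity.Cruxes.TautCompressionIntegrable.Birth

set_option linter.unusedVariables false
set_option linter.dupNamespace false

/-- **stub E — `stub_conclusion_of_hasSmoothExtensionPast` (regular regime; PROVED, LANDED p159529 as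
`Theorems/TautLoopKelvinTautCompressionIntegrableStubExtension.lean`).** For a classical solution of unforced NS on
`ℝ³ × [0,T)`, Leray–Hopf on `[0,T]` from a rapidly decaying datum, which extends classically past `T`, the conclusion
of K1 holds at every level `g > 0` (`Φ :≡ L` with `‖Du‖ ≤ L` on `[0,T) × ℝ³`). -/
theorem stub_conclusion_of_hasSmoothExtensionPast :
    ∀ (ν T : ℝ), 0 < ν → 0 < T →
      ∀ (u : ℝ → EuclideanSpace ℝ (Fin 3) → EuclideanSpace ℝ (Fin 3)) (p : ℝ → EuclideanSpace ℝ (Fin 3) → ℝ),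
      Literature.Analysis.FluidPDE.IsClassicalNSSolutionOn (Set.Ico 0 T) ν 0 u p →
      Literature.Analysis.FluidPDE.IsLerayHopfOn T ν 0 (u 0) u →
      Literature.Analysis.FluidPDE.HasRapidSpatialDecay (u 0) →
      Literature.Analysis.FluidPDE.HasSmoothExtensionPast ν 0 u T →
      ∀ g : ℝ, 0 < g → ∃ (Φ : ℝ → ℝ) (M : ℝ), Measurable Φ ∧ 0 ≤ M ∧
        (∀ s ∈ Set.Ioo 0 T, (⨅ ε : {ε : ℝ // 0 < ε}, sSup {k : ℝ | ∃ γ : ℝ → EuclideanSpace ℝ (Fin 3),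
          Literature.Analysis.FluidPDE.IsC1Loop γ ∧ g ≤ |Literature.Analysis.FluidPDE.circulation (u s) γ| ∧
          ENNReal.ofReal (∫ σ in (0:ℝ)..1, ‖deriv γ σ‖) ≤
            (⨅ (γ' : ℝ → EuclideanSpace ℝ (Fin 3)) (_ : Literature.Analysis.FluidPDE.IsC1Loop γ' ∧
              g ≤ |Literature.Analysis.FluidPDE.circulation (u s) γ'|), ENNReal.ofReal (∫ σ in (0:ℝ)..1, ‖deriv γ' σ‖)) +
            ENNReal.ofReal (ε : ℝ) ∧
          k = ((∫ σ in (0:ℝ)..1, -(inner ℝ (deriv γ σ) (fderiv ℝ (u s) (γ σ) (deriv γ σ))) / ‖deriv γ σ‖) /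
            (∫ σ in (0:ℝ)..1, ‖deriv γ σ‖))}) ≤ Φ s) ∧
        (∫⁻ s in Set.Ioo 0 T, ENNReal.ofReal (Φ s)) ≤ ENNReal.ofReal M :=
  -- LANDED p159529 (Theorems/TautLoopKelvinTautCompressionIntegrableStubExtension.lean)
  Summit.NavierStokesRegularity.NavierStokesRegularity.Theorems.TautCompressionIntegrable.Birth.stub_conclusion_of_hasSmoothExtensionPast

/-- **stub 3′ — `stub_typeIBlowup_endgame` (genuine Type-I blow-up at `T`; OPEN).** For a classical Leray–Hopf solution
from a rapidly decaying datum on `[0,T)` which does NOT extend classically past `T` but has the Type-I rate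
`‖u(t,x)‖ ≤ C/√(T−t)` near `T` (`IsTypeIBlowup u T`), the conclusion of K1 holds at every level `g > 0`.
Implied by the open item `TypeICertificateLadder.NoTypeIBlowup` (stmt-1217), under which the regime is empty. -/
theorem stub_typeIBlowup_endgame :
    ∀ (ν T : ℝ), 0 < ν → 0 < T →
      ∀ (u : ℝ → EuclideanSpace ℝ (Fin 3) → EuclideanSpace ℝ (Fin 3)) (p : ℝ → EuclideanSpace ℝ (Fin 3) → ℝ),
      Literature.Analysis.FluidPDE.IsClassicalNSSolutionOn (Set.Ico 0 T) ν 0 u p →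
      Literature.Analysis.FluidPDE.IsLerayHopfOn T ν 0 (u 0) u →
      Literature.Analysis.FluidPDE.HasRapidSpatialDecay (u 0) →
      ¬ Literature.Analysis.FluidPDE.HasSmoothExtensionPast ν 0 u T →
      Literature.Analysis.FluidPDE.IsTypeIBlowup u T →
      ∀ g : ℝ, 0 < g → ∃ (Φ : ℝ → ℝ) (M : ℝ), Measurable Φ ∧ 0 ≤ M ∧
        (∀ s ∈ Set.Ioo 0 T, (⨅ ε : {ε : ℝ // 0 < ε}, sSup {k : ℝ | ∃ γ : ℝ → EuclideanSpace ℝ (Fin 3),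
          Literature.Analysis.FluidPDE.IsC1Loop γ ∧ g ≤ |Literature.Analysis.FluidPDE.circulation (u s) γ| ∧
          ENNReal.ofReal (∫ σ in (0:ℝ)..1, ‖deriv γ σ‖) ≤
            (⨅ (γ' : ℝ → EuclideanSpace ℝ (Fin 3)) (_ : Literature.Analysis.FluidPDE.IsC1Loop γ' ∧
              g ≤ |Literature.Analysis.FluidPDE.circulation (u s) γ'|), ENNReal.ofReal (∫ σ in (0:ℝ)..1, ‖deriv γ' σ‖)) +
            ENNReal.ofReal (ε : ℝ) ∧
          k = ((∫ σ in (0:ℝ)..1, -(inner ℝ (deriv γ σ) (fderiv ℝ (u s) (γ σ) (deriv γ σ))) / ‖deriv γ σ‖) /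
            (∫ σ in (0:ℝ)..1, ‖deriv γ σ‖))}) ≤ Φ s) ∧
        (∫⁻ s in Set.Ioo 0 T, ENNReal.ofReal (Φ s)) ≤ ENNReal.ofReal M := by
  sorry

/-- **stub 4′ — `stub_nonTypeIBlowup_endgame` (genuine blow-up at `T` without the Type-I rate; OPEN, hardest).** For a
classical Leray–Hopf solution from a rapidly decaying datum on `[0,T)` which does NOT extend classically past `T` and
whose growth at `T` is NOT of Type-I rate (`¬ IsTypeIBlowup u T`), the conclusion of K1 holds at every level `g > 0`.
Implied by the open item `TypeICertificateLadder.NoTypeII` (stmt-0056), under which the regime is empty. -/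
theorem stub_nonTypeIBlowup_endgame :
    ∀ (ν T : ℝ), 0 < ν → 0 < T →
      ∀ (u : ℝ → EuclideanSpace ℝ (Fin 3) → EuclideanSpace ℝ (Fin 3)) (p : ℝ → EuclideanSpace ℝ (Fin 3) → ℝ),
      Literature.Analysis.FluidPDE.IsClassicalNSSolutionOn (Set.Ico 0 T) ν 0 u p →
      Literature.Analysis.FluidPDE.IsLerayHopfOn T ν 0 (u 0) u →
      Literature.Analysis.FluidPDE.HasRapidSpatialDecay (u 0) →
      ¬ Literature.Analysis.FluidPDE.HasSmoothExtensionPast ν 0 u T →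
      ¬ Literature.Analysis.FluidPDE.IsTypeIBlowup u T →
      ∀ g : ℝ, 0 < g → ∃ (Φ : ℝ → ℝ) (M : ℝ), Measurable Φ ∧ 0 ≤ M ∧
        (∀ s ∈ Set.Ioo 0 T, (⨅ ε : {ε : ℝ // 0 < ε}, sSup {k : ℝ | ∃ γ : ℝ → EuclideanSpace ℝ (Fin 3),
          Literature.Analysis.FluidPDE.IsC1Loop γ ∧ g ≤ |Literature.Analysis.FluidPDE.circulation (u s) γ| ∧
          ENNReal.ofReal (∫ σ in (0:ℝ)..1, ‖deriv γ σ‖) ≤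
            (⨅ (γ' : ℝ → EuclideanSpace ℝ (Fin 3)) (_ : Literature.Analysis.FluidPDE.IsC1Loop γ' ∧
              g ≤ |Literature.Analysis.FluidPDE.circulation (u s) γ'|), ENNReal.ofReal (∫ σ in (0:ℝ)..1, ‖deriv γ' σ‖)) +
            ENNReal.ofReal (ε : ℝ) ∧
          k = ((∫ σ in (0:ℝ)..1, -(inner ℝ (deriv γ σ) (fderiv ℝ (u s) (γ σ) (deriv γ σ))) / ‖deriv γ σ‖) /
            (∫ σ in (0:ℝ)..1, ‖deriv γ σ‖))}) ≤ Φ s) ∧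
        (∫⁻ s in Set.Ioo 0 T, ENNReal.ofReal (Φ s)) ≤ ENNReal.ofReal M := by
  sorry

/-- **Closed composition (kernel-checked, no sorry): the three stub STATEMENTS imply the crux statement, verbatim.**
Excluded middle on `HasSmoothExtensionPast ν 0 u T` (regular regime: stub E), then on `IsTypeIBlowup u T`
(stubs 3′ / 4′). (Its conclusion is the crux unfolded once, so that `TautCompressionIntegrable_of` below is the only
theorem of the file concluding the crux by name.) -/
theorem TautCompressionIntegrable_of_signatures
    (hE : ∀ (ν T : ℝ), 0 < ν → 0 < T →
      ∀ (u : ℝ → EuclideanSpace ℝ (Fin 3) → EuclideanSpace ℝ (Fin 3)) (p : ℝ → EuclideanSpace ℝ (Fin 3) → ℝ),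
      Literature.Analysis.FluidPDE.IsClassicalNSSolutionOn (Set.Ico 0 T) ν 0 u p →
      Literature.Analysis.FluidPDE.IsLerayHopfOn T ν 0 (u 0) u →
      Literature.Analysis.FluidPDE.HasRapidSpatialDecay (u 0) →
      Literature.Analysis.FluidPDE.HasSmoothExtensionPast ν 0 u T →
      ∀ g : ℝ, 0 < g → ∃ (Φ : ℝ → ℝ) (M : ℝ), Measurable Φ ∧ 0 ≤ M ∧
        (∀ s ∈ Set.Ioo 0 T, (⨅ ε : {ε : ℝ // 0 < ε}, sSup {k : ℝ | ∃ γ : ℝ → EuclideanSpace ℝ (Fin 3),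
          Literature.Analysis.FluidPDE.IsC1Loop γ ∧ g ≤ |Literature.Analysis.FluidPDE.circulation (u s) γ| ∧
          ENNReal.ofReal (∫ σ in (0:ℝ)..1, ‖deriv γ σ‖) ≤
            (⨅ (γ' : ℝ → EuclideanSpace ℝ (Fin 3)) (_ : Literature.Analysis.FluidPDE.IsC1Loop γ' ∧
              g ≤ |Literature.Analysis.FluidPDE.circulation (u s) γ'|), ENNReal.ofReal (∫ σ in (0:ℝ)..1, ‖deriv γ' σ‖)) +
            ENNReal.ofReal (ε : ℝ) ∧
          k = ((∫ σ in (0:ℝ)..1, -(inner ℝ (deriv γ σ) (fderiv ℝ (u s) (γ σ) (deriv γ σ))) / ‖deriv γ σ‖) /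
            (∫ σ in (0:ℝ)..1, ‖deriv γ σ‖))}) ≤ Φ s) ∧
        (∫⁻ s in Set.Ioo 0 T, ENNReal.ofReal (Φ s)) ≤ ENNReal.ofReal M)
    (h₃ : ∀ (ν T : ℝ), 0 < ν → 0 < T →
      ∀ (u : ℝ → EuclideanSpace ℝ (Fin 3) → EuclideanSpace ℝ (Fin 3)) (p : ℝ → EuclideanSpace ℝ (Fin 3) → ℝ),
      Literature.Analysis.FluidPDE.IsClassicalNSSolutionOn (Set.Ico 0 T) ν 0 u p →
      Literature.Analysis.FluidPDE.IsLerayHopfOn T ν 0 (u 0) u →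
      Literature.Analysis.FluidPDE.HasRapidSpatialDecay (u 0) →
      ¬ Literature.Analysis.FluidPDE.HasSmoothExtensionPast ν 0 u T →
      Literature.Analysis.FluidPDE.IsTypeIBlowup u T →
      ∀ g : ℝ, 0 < g → ∃ (Φ : ℝ → ℝ) (M : ℝ), Measurable Φ ∧ 0 ≤ M ∧
        (∀ s ∈ Set.Ioo 0 T, (⨅ ε : {ε : ℝ // 0 < ε}, sSup {k : ℝ | ∃ γ : ℝ → EuclideanSpace ℝ (Fin 3),
          Literature.Analysis.FluidPDE.IsC1Loop γ ∧ g ≤ |Literature.Analysis.FluidPDE.circulation (u s) γ| ∧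
          ENNReal.ofReal (∫ σ in (0:ℝ)..1, ‖deriv γ σ‖) ≤
            (⨅ (γ' : ℝ → EuclideanSpace ℝ (Fin 3)) (_ : Literature.Analysis.FluidPDE.IsC1Loop γ' ∧
              g ≤ |Literature.Analysis.FluidPDE.circulation (u s) γ'|), ENNReal.ofReal (∫ σ in (0:ℝ)..1, ‖deriv γ' σ‖)) +
            ENNReal.ofReal (ε : ℝ) ∧
          k = ((∫ σ in (0:ℝ)..1, -(inner ℝ (deriv γ σ) (fderiv ℝ (u s) (γ σ) (deriv γ σ))) / ‖deriv γ σ‖) /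
            (∫ σ in (0:ℝ)..1, ‖deriv γ σ‖))}) ≤ Φ s) ∧
        (∫⁻ s in Set.Ioo 0 T, ENNReal.ofReal (Φ s)) ≤ ENNReal.ofReal M)
    (h₄ : ∀ (ν T : ℝ), 0 < ν → 0 < T →
      ∀ (u : ℝ → EuclideanSpace ℝ (Fin 3) → EuclideanSpace ℝ (Fin 3)) (p : ℝ → EuclideanSpace ℝ (Fin 3) → ℝ),
      Literature.Analysis.FluidPDE.IsClassicalNSSolutionOn (Set.Ico 0 T) ν 0 u p →
      Literature.Analysis.FluidPDE.IsLerayHopfOn T ν 0 (u 0) u →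
      Literature.Analysis.FluidPDE.HasRapidSpatialDecay (u 0) →
      ¬ Literature.Analysis.FluidPDE.HasSmoothExtensionPast ν 0 u T →
      ¬ Literature.Analysis.FluidPDE.IsTypeIBlowup u T →
      ∀ g : ℝ, 0 < g → ∃ (Φ : ℝ → ℝ) (M : ℝ), Measurable Φ ∧ 0 ≤ M ∧
        (∀ s ∈ Set.Ioo 0 T, (⨅ ε : {ε : ℝ // 0 < ε}, sSup {k : ℝ | ∃ γ : ℝ → EuclideanSpace ℝ (Fin 3),
          Literature.Analysis.FluidPDE.IsC1Loop γ ∧ g ≤ |Literature.Analysis.FluidPDE.circulation (u s) γ| ∧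
          ENNReal.ofReal (∫ σ in (0:ℝ)..1, ‖deriv γ σ‖) ≤
            (⨅ (γ' : ℝ → EuclideanSpace ℝ (Fin 3)) (_ : Literature.Analysis.FluidPDE.IsC1Loop γ' ∧
              g ≤ |Literature.Analysis.FluidPDE.circulation (u s) γ'|), ENNReal.ofReal (∫ σ in (0:ℝ)..1, ‖deriv γ' σ‖)) +
            ENNReal.ofReal (ε : ℝ) ∧
          k = ((∫ σ in (0:ℝ)..1, -(inner ℝ (deriv γ σ) (fderiv ℝ (u s) (γ σ) (deriv γ σ))) / ‖deriv γ σ‖) /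
            (∫ σ in (0:ℝ)..1, ‖deriv γ σ‖))}) ≤ Φ s) ∧
        (∫⁻ s in Set.Ioo 0 T, ENNReal.ofReal (Φ s)) ≤ ENNReal.ofReal M) :
    ∀ (ν T : ℝ), 0 < ν → 0 < T →
      ∀ (u : ℝ → EuclideanSpace ℝ (Fin 3) → EuclideanSpace ℝ (Fin 3)) (p : ℝ → EuclideanSpace ℝ (Fin 3) → ℝ),
      Literature.Analysis.FluidPDE.IsClassicalNSSolutionOn (Set.Ico 0 T) ν 0 u p →
      Literature.Analysis.FluidPDE.IsLerayHopfOn T ν 0 (u 0) u →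
      Literature.Analysis.FluidPDE.HasRapidSpatialDecay (u 0) →
      ∀ g : ℝ, 0 < g → ∃ (Φ : ℝ → ℝ) (M : ℝ), Measurable Φ ∧ 0 ≤ M ∧
        (∀ s ∈ Set.Ioo 0 T, (⨅ ε : {ε : ℝ // 0 < ε}, sSup {k : ℝ | ∃ γ : ℝ → EuclideanSpace ℝ (Fin 3),
          Literature.Analysis.FluidPDE.IsC1Loop γ ∧ g ≤ |Literature.Analysis.FluidPDE.circulation (u s) γ| ∧
          ENNReal.ofReal (∫ σ in (0:ℝ)..1, ‖deriv γ σ‖) ≤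
            (⨅ (γ' : ℝ → EuclideanSpace ℝ (Fin 3)) (_ : Literature.Analysis.FluidPDE.IsC1Loop γ' ∧
              g ≤ |Literature.Analysis.FluidPDE.circulation (u s) γ'|), ENNReal.ofReal (∫ σ in (0:ℝ)..1, ‖deriv γ' σ‖)) +
            ENNReal.ofReal (ε : ℝ) ∧
          k = ((∫ σ in (0:ℝ)..1, -(inner ℝ (deriv γ σ) (fderiv ℝ (u s) (γ σ) (deriv γ σ))) / ‖deriv γ σ‖) /
            (∫ σ in (0:ℝ)..1, ‖deriv γ σ‖))}) ≤ Φ s) ∧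
        (∫⁻ s in Set.Ioo 0 T, ENNReal.ofReal (Φ s)) ≤ ENNReal.ofReal M := by
  intro ν T hν hT u p hcl hLH hdec g hg
  by_cases hext : Literature.Analysis.FluidPDE.HasSmoothExtensionPast ν 0 u T
  · exact hE ν T hν hT u p hcl hLH hdec hext g hg
  · by_cases hI : Literature.Analysis.FluidPDE.IsTypeIBlowup u T
    · exact h₃ ν T hν hT u p hcl hLH hdec hext hI g hg
    · exact h₄ ν T hν hT u p hcl hLH hdec hext hI g hg

/-- **Birth composition (the skeleton theorem read by `#h21_check_skeleton`): the crux BY NAME from the three registered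
stubs BY NAME** — no `Prop` hypotheses, no direct `sorry`:
`TautCompressionIntegrable_of = TautCompressionIntegrable_of_signatures stubE stub3′ stub4′`. -/
theorem TautCompressionIntegrable_of :
    Summit.NavierStokesRegularity.NavierStokesRegularity.Theses.TautLoopKelvin.TautCompressionIntegrable :=
  TautCompressionIntegrable_of_signatures stub_conclusion_of_hasSmoothExtensionPast
    stub_typeIBlowup_endgame stub_nonTypeIBlowup_endgame

end Summit.NavierStokesRegularity.NavierStokesRegularity.Cruxes.TautCompressionIntegrable.Birth

end
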